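import Mathlib
import HarnessLib

/-!
# OneHandleUniqueness

Topic `Literature/Topology/FourManifolds`. Named literature fact(s) relocated by the gate from `Summits/SmoothPoincare4/SmoothPoincare4/Theorems/DottedCircleRasmussenDcrGapHelperHandlebodyChartNamedFacts.lean`
(accept-time relocation of `[cite]`d propositions written inline in a Summits proposal; human ruling 2026-08-15).
Sources: HirschDT1976, MilnorHCobordism1965, Whitney1936.

* `Literature.Topology.FourManifolds.arcs_ambientIsotopic_rel_of_homotopicRel`
* `Literature.Topology.FourManifolds.oneHandle_ambientIsotopic_upToTwist`
-/

namespace Literature.Topology.FourManifolds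

/-- **Uniqueness of `1`-handles along a common core, rel feet and rel a closed set, up to the fibre
twist (Hirsch 1976, Ch. 4 §5 Thm. 5.3 — uniqueness of tubular neighbourhoods — with the isotopy
extension theorem Ch. 8 §1 Thm. 1.3; the twist is the class of the fibre-derivative loop in
`π₁(GL₃⁺(ℝ)) = π₁(SO(3)) = ℤ/2`).**  Let `X` be a closed smooth `4`-manifold and
`h₀, h₁ : ℝ⁴ → X` two `1`-handles read on the solid cylinder
`T = {p : |p₀| ≤ 1, p₁² + p₂² + p₃² ≤ 1}` (longitudinal coordinate `p₀`, fibre `(p₁, p₂, p₃)`):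
smooth, injective and immersive on an open `W ⊇ T`, EQUAL near the feet (`h₀ p = h₁ p` for
`p ∈ W`, `|p₀| > 1 - η`) and with the SAME CORE (`h₀ = h₁` on `{(t, 0, 0, 0) : |t| ≤ 1}`).  Let
`Z ⊆ X` be closed and missed by both tubes away from the feet (`hᵢ p ∉ Z` for `p ∈ T`,
`|p₀| ≤ 1 - η/2`).  Then for some `m ∈ ℤ` there is a diffeomorphism `Φ` of `X` fixing `Z`
pointwise with `Φ (h₀ p) = h₁ (R_m p)` on `T`, where `R_m` rotates the fibre coordinates
`(p₂, p₃)` by the angle `2π m χ(p₀ + 1/2)` (`χ = Real.smoothTransition`; `R_m = id` for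
`|p₀| ≥ 1/2`, the standard generator of `π₁(SO(3))` for odd `m`).  (Proof in the source's terms:
shrink the fibres of `h₀` where `|p₀| ≤ 1 - η`, Alexander isotopy of `h₁⁻¹ ∘ h₀` to its fibre
derivative, a loop in `GL₃⁺` based at `1`, homotopic rel ends to `R_m`; all isotopies are stationary
near the feet and their tracks stay in the tubes off `Z`, so they extend ambiently rel `Z`.)
Vendored in dimension `4` with the explicit representative `R_m`, a special case of the printed
statements. [cite: HirschDT1976, Ch. 4 §5 Thm. 5.3 and Ch. 8 §1 Thm. 1.3]
[file Topology/FourManifolds/OneHandleUniqueness] -/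
def oneHandle_ambientIsotopic_upToTwist : Prop :=
  ∀ (X : Type) [TopologicalSpace X] [T2Space X] [SecondCountableTopology X] [CompactSpace X]
    [ChartedSpace (EuclideanSpace ℝ (Fin 4)) X] [IsManifold (modelWithCornersSelf ℝ (EuclideanSpace ℝ (Fin 4))) ((⊤ : ℕ∞) : WithTop ℕ∞) X]
    (W : Set (EuclideanSpace ℝ (Fin 4))) (h₀ h₁ : EuclideanSpace ℝ (Fin 4) → X) (Z : Set X) (η : ℝ),
    0 < η → η ≤ 1 → IsOpen W →
    {p : EuclideanSpace ℝ (Fin 4) | |p 0| ≤ 1 ∧ (p 1) ^ 2 + (p 2) ^ 2 + (p 3) ^ 2 ≤ 1} ⊆ W →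
    (ContMDiffOn (modelWithCornersSelf ℝ (EuclideanSpace ℝ (Fin 4))) (modelWithCornersSelf ℝ (EuclideanSpace ℝ (Fin 4))) ((⊤ : ℕ∞) : WithTop ℕ∞) h₀ W ∧ Set.InjOn h₀ W ∧
      ∀ p ∈ W, Function.Injective (mfderiv (modelWithCornersSelf ℝ (EuclideanSpace ℝ (Fin 4))) (modelWithCornersSelf ℝ (EuclideanSpace ℝ (Fin 4))) h₀ p)) →
    (ContMDiffOn (modelWithCornersSelf ℝ (EuclideanSpace ℝ (Fin 4))) (modelWithCornersSelf ℝ (EuclideanSpace ℝ (Fin 4))) ((⊤ : ℕ∞) : WithTop ℕ∞) h₁ W ∧ Set.InjOn h₁ W ∧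
      ∀ p ∈ W, Function.Injective (mfderiv (modelWithCornersSelf ℝ (EuclideanSpace ℝ (Fin 4))) (modelWithCornersSelf ℝ (EuclideanSpace ℝ (Fin 4))) h₁ p)) →
    (∀ p ∈ W, 1 - η < |p 0| → h₀ p = h₁ p) →
    (∀ t : ℝ, |t| ≤ 1 → h₀ (!₂[t, 0, 0, 0]) = h₁ (!₂[t, 0, 0, 0])) →
    IsClosed Z →
    (∀ p : EuclideanSpace ℝ (Fin 4), |p 0| ≤ 1 - η / 2 → (p 1) ^ 2 + (p 2) ^ 2 + (p 3) ^ 2 ≤ 1 →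
      h₀ p ∉ Z ∧ h₁ p ∉ Z) →
    ∃ (m : ℤ) (Φ : Diffeomorph (modelWithCornersSelf ℝ (EuclideanSpace ℝ (Fin 4))) (modelWithCornersSelf ℝ (EuclideanSpace ℝ (Fin 4))) X X ((⊤ : ℕ∞) : WithTop ℕ∞)), (∀ z ∈ Z, Φ z = z) ∧
      ∀ p : EuclideanSpace ℝ (Fin 4), |p 0| ≤ 1 → (p 1) ^ 2 + (p 2) ^ 2 + (p 3) ^ 2 ≤ 1 →
        Φ (h₀ p) = h₁ (!₂[p 0, p 1,
          Real.cos (2 * Real.pi * (m : ℝ) * Real.smoothTransition (p 0 + 1 / 2)) * p 2 -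
            Real.sin (2 * Real.pi * (m : ℝ) * Real.smoothTransition (p 0 + 1 / 2)) * p 3,
          Real.sin (2 * Real.pi * (m : ℝ) * Real.smoothTransition (p 0 + 1 / 2)) * p 2 +
            Real.cos (2 * Real.pi * (m : ℝ) * Real.smoothTransition (p 0 + 1 / 2)) * p 3])

/-- **Arcs homotopic rel ends are ambient isotopic rel ends, and rel a closed set the homotopies
avoid (Whitney 1936, §II Thm. 6: homotopic embeddings of a compact `m`-manifold in an
`n`-manifold are isotopic for `n ≥ 2m + 2` — Milnor 1965, Thm. 8.4 and Remark, here `m = 1`,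
`n = 4`, for the compact `1`-manifold `⊔ⱼ [-1, 1]` rel its ends; made ambient and rel `Z` by the
isotopy extension theorem, Hirsch 1976 Ch. 8 §1 Thm. 1.3).**  Let `X` be a closed smooth
`4`-manifold, `a₀ʲ, a₁ʲ : ℝ → X` (`j < n`) two families of arcs, each arc smooth, injective and
immersive on an open `W ⊇ [-1, 1]`, each family pairwise disjoint on `W`, with `a₀ʲ = a₁ʲ` near the
ends (`|t| > 1 - η`), and `Hʲ : ℝ × ℝ → X` continuous homotopies `Hʲ(0, ·) = a₀ʲ`, `Hʲ(1, ·) = a₁ʲ`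
on `[-1, 1]`, stationary (`= a₀ʲ`) for `|t| ≥ 1 - η`, whose moving parts `Hʲ(s, t)`, `s ∈ [0, 1]`,
`|t| ≤ 1 - η`, miss the closed set `Z`.  Then some diffeomorphism `Φ` of `X` fixes `Z` pointwise
and carries every `a₀ʲ` to `a₁ʲ` on `[-1, 1]`.  (The homotopies of different arcs may meet each
other and the arcs: general position is part of Whitney's theorem.)  Vendored in dimension `4`,
a special case of the printed statements.
[cite: Whitney1936, §II Thm. 6] [cite: MilnorHCobordism1965, Thm. 8.4 and Remark (PDF p. 56)]
[cite: HirschDT1976, Ch. 8 §1, Thm. 1.3] [file Topology/FourManifolds/OneHandleUniqueness] -/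
def arcs_ambientIsotopic_rel_of_homotopicRel : Prop :=
  ∀ (X : Type) [TopologicalSpace X] [T2Space X] [SecondCountableTopology X] [CompactSpace X]
    [ChartedSpace (EuclideanSpace ℝ (Fin 4)) X] [IsManifold (modelWithCornersSelf ℝ (EuclideanSpace ℝ (Fin 4))) ((⊤ : ℕ∞) : WithTop ℕ∞) X]
    (n : ℕ) (W : Set ℝ) (a₀ a₁ : Fin n → ℝ → X) (H : Fin n → ℝ × ℝ → X) (Z : Set X) (η : ℝ),
    0 < η → η ≤ 1 → IsOpen W → Set.Icc (-1 : ℝ) 1 ⊆ W →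
    (∀ j, ContMDiffOn (modelWithCornersSelf ℝ ℝ) (modelWithCornersSelf ℝ (EuclideanSpace ℝ (Fin 4))) ((⊤ : ℕ∞) : WithTop ℕ∞) (a₀ j) W ∧ Set.InjOn (a₀ j) W ∧
      ∀ t ∈ W, Function.Injective (mfderiv (modelWithCornersSelf ℝ ℝ) (modelWithCornersSelf ℝ (EuclideanSpace ℝ (Fin 4))) (a₀ j) t)) →
    (∀ j, ContMDiffOn (modelWithCornersSelf ℝ ℝ) (modelWithCornersSelf ℝ (EuclideanSpace ℝ (Fin 4))) ((⊤ : ℕ∞) : WithTop ℕ∞) (a₁ j) W ∧ Set.InjOn (a₁ j) W ∧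
      ∀ t ∈ W, Function.Injective (mfderiv (modelWithCornersSelf ℝ ℝ) (modelWithCornersSelf ℝ (EuclideanSpace ℝ (Fin 4))) (a₁ j) t)) →
    (∀ j l, j ≠ l → ∀ t ∈ W, ∀ s ∈ W, a₀ j t ≠ a₀ l s) →
    (∀ j l, j ≠ l → ∀ t ∈ W, ∀ s ∈ W, a₁ j t ≠ a₁ l s) →
    (∀ j, ∀ t ∈ W, 1 - η < |t| → a₀ j t = a₁ j t) →
    (∀ j, Continuous (H j)) →
    (∀ j, ∀ t ∈ Set.Icc (-1 : ℝ) 1, H j (0, t) = a₀ j t ∧ H j (1, t) = a₁ j t) →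
    (∀ j, ∀ s ∈ Set.Icc (0 : ℝ) 1, ∀ t ∈ Set.Icc (-1 : ℝ) 1, 1 - η ≤ |t| → H j (s, t) = a₀ j t) →
    IsClosed Z →
    (∀ j, ∀ s ∈ Set.Icc (0 : ℝ) 1, ∀ t ∈ Set.Icc (-1 : ℝ) 1, |t| ≤ 1 - η → H j (s, t) ∉ Z) →
    ∃ Φ : Diffeomorph (modelWithCornersSelf ℝ (EuclideanSpace ℝ (Fin 4))) (modelWithCornersSelf ℝ (EuclideanSpace ℝ (Fin 4))) X X ((⊤ : ℕ∞) : WithTop ℕ∞), (∀ z ∈ Z, Φ z = z) ∧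
      ∀ j, ∀ t ∈ Set.Icc (-1 : ℝ) 1, Φ (a₀ j t) = a₁ j t

/-! ## The model cylinder -/

end Literature.Topology.FourManifolds
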